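import Summits.Ventures.HSemireg.PhaseTorusBoxLaw
import Summits.Ventures.HSemireg.PhaseTorusLawCoranks
import Summits.Ventures.HSemireg.Pad4TowerLinePhaseTorus

/-!
# PAD-4 on 𝔅(μ₄): the BAND BOX LAW, part 1 — the box-mass law WITH MASS on the torus, axial letters, and the SMEARED phase measure
# of an axial design with its Fourier transform (HSemireg support file; phase-torus line, «control» lens g6 CYCLE LINE #2 «BAND BOX LAW», module 1 of 2)

Crux of record: `Summit.HodgeConjecture.HodgeConjecture.Theses.EightfoldBlochSeeds.BlochSeedDiscOne`
(= `HasHyperbolicBlochSeed 4 1`, item stmt-HodgeConjecture-18881; skeleton `Lines/birth.lean`, STUB R `stub_rung_pad4_seedAt`,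
named technique = PAD-4 two-level ⊕-block design with a TWO-TERM line-bundle presentation).
Nothing in this file proves HC, HC_AV, HC_CM, H2 or item 18881; census-neutral (no SAT∕UNSAT row is added or changed).

WHAT THIS FILE IS (tree copy of §1 and §2a–§2c of the crux workfile `Cruxes/BlochSeedDiscOne/BandPhaseTorusBoxLaw.lean` e5e8b2d03c640a2f,
author plan-lens-HodgeAV-control g6, statements verbatim; pen proof + data 14∕14 band + 41∕41 line designs: memo `Cruxes/BlochSeedDiscOne/BOX-LAW-g6.md`
§9; director-hodge word «K-BAND16»; critic idea-crit-6 g12 KERNEL PLATE l.6826):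
* §1 TORUS LEVEL (general mass): `PhaseTorusBoxLaw.boxSumLaw` assumed ALL clean moments vanish, including the mass `ω̂(0)`; for band
  alphabets the mass `M₀ = N(cccc)` is not zero, so here the frequency-`0` term is kept: **`boxSumLaw'`** (`boxLaw'` in the workfile —
  renamed, `PhaseTorus.boxLaw'` being the unfolded hosted-set law of `Pad4TowerLineStaticSpread`) —
  `32 · N(s) = 2 · (Σ_τ ω τ) − Re(e(−Σ s) · μ)` whenever `moment ω k = 0` for every clean `k ≠ 0` (`box_pairing'`).
* §2a AXIAL letters `(a, b·ζ_k)` (`axLetter`, `AxCell`; every letter of every `◇_h`, every LINE letter), moduli `babs`, band DEFECTS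
  `defect = c_f − b_f`; §2b the letters in `ℂ` (`β_f = b_f · e(τ_f)`, `letterC`, `toComplex_mono_wordOf_ax`);
* §2c the SMEARED measure `omegaB` = `Σ ±m · ⊗_f (b_f · δ_{τ_f} + (d_f ∕ 4) · 𝟙)` on `(μ₄)⁴`: its torus moments at `2`-free frequencies
  are EXACTLY the design moments in the letters `c, β, β̄` (**`omegaB_moment`**), so (A1) ⇒ clean off `{0, ±(1,1,1,1)}` by the
  alphabet-free `moment_eq_zero_of_beta` (**`omegaB_clean`**), mass `= M₀` (`mass`, **`omegaB_mass`**), top moment `= μ` (**`omegaB_top`**).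
Everything here is PROVED (axioms `propext`, `Classical.choice`, `Quot.sound`; no `sorry`, no named fact, no instance, no notation).

WHAT IT IS NOT: a statement about sheaves, monads, a SOURCE or a SEED.  The box masses `16·N(s) = W(s)`, **`axialDesign_mu_eq`**,
the lattice `16(1+i)ℤ[i]` (**`axialDesign_mu_dvd`**) and the `◇_h` corollary are the sequel `Pad4TowerBandBoxLaw`.
Tree filing: hsemireg-phasetorus-typer-1 g2.
-/

namespace Summit.Ventures.HSemireg.PhaseTorus

open Finset BigOperators

/-! ## §1 torus level: the box law with general mass -/

/-- the frequency-`0` coefficient of the pair indicator is `1/2`. -/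
theorem coefBox_zero (s : ZMod 4) : coefBox s 0 = 1 / 2 := by simp [coefBox]

/-- the frequency-`0` coefficient of a full box indicator is `1/16`. -/
theorem prod_svec_zero_univ (s : PT) : ∏ f, svec Finset.univ s f 0 = 1 / 16 := by
  have h : ∀ f, svec Finset.univ s f 0 = 1 / 2 := fun f => by simp [svec, coefBox_zero]
  simp_rw [h]
  rw [Finset.prod_const, Finset.card_univ, Fintype.card_fin]
  norm_num

/-- the moment at frequency `0` is the total mass. -/
theorem moment_zero_eq_sum (ω : PT → ℝ) : moment ω 0 = ((∑ τ, ω τ : ℝ) : ℂ) := by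
  unfold moment
  push_cast
  refine Finset.sum_congr rfl fun τ _ => ?_
  rw [show chi 0 τ = 1 from by simp [chi]]
  ring

/-- the three-term reduction of the box pairing when only the NON-ZERO clean moments vanish. -/
theorem box_pairing' (ω : PT → ℝ) (hK : ∀ k, KAdm k → k ≠ 0 → moment ω k = 0) (s : PT) :
    ((boxSum ω s : ℝ) : ℂ) = (1 / 16 : ℂ) * ((∑ τ, ω τ : ℝ) : ℂ) +
      ((∏ f, svec Finset.univ s f 1) * moment ω (fun _ => 1) +
        (starRingEnd ℂ) ((∏ f, svec Finset.univ s f 1) * moment ω (fun _ => 1))) := by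
  have hS := pairing_expansion ω (svec Finset.univ s)
  set b := svec Finset.univ s with hb
  have h01 : (0 : PT) ≠ (fun _ => (1 : ZMod 4)) := fun h => absurd (congr_fun h 0) (by decide)
  have h03 : (0 : PT) ≠ (fun _ => (3 : ZMod 4)) := fun h => absurd (congr_fun h 0) (by decide)
  have h13 : (fun _ => (1 : ZMod 4) : PT) ≠ (fun _ => 3) := fun h => absurd (congr_fun h 0) (by decide)
  have hred : ∑ k : PT, (∏ f, b f (k f)) * moment ω k =
      (∏ f, b f ((0 : PT) f)) * moment ω 0 + ((∏ f, b f 1) * moment ω (fun _ => 1) +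
        (∏ f, b f 3) * moment ω (fun _ => 3)) := by
    have hsub : ∑ k : PT, (∏ f, b f (k f)) * moment ω k =
        ∑ k ∈ ({(0 : PT), (fun _ => 1), (fun _ => 3)} : Finset PT), (∏ f, b f (k f)) * moment ω k := by
      symm
      refine Finset.sum_subset (Finset.subset_univ _) fun k _ hk => ?_
      simp only [Finset.mem_insert, Finset.mem_singleton, not_or] at hk
      by_cases h : ∃ f, k f = 2
      · obtain ⟨f, hf⟩ := h
        rw [Finset.prod_eq_zero (Finset.mem_univ f) (by rw [hf, hb, svec_two]), zero_mul]
      · rw [hK k ⟨fun f hf => h ⟨f, hf⟩, hk.2.1, hk.2.2⟩ hk.1, mul_zero]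
    rw [hsub, Finset.sum_insert (by simp [h01, h03]), Finset.sum_insert (by simp [h13]), Finset.sum_singleton]
  have hc3 : ∏ f, b f 3 = (starRingEnd ℂ) (∏ f, b f 1) := by
    rw [map_prod]; exact Finset.prod_congr rfl fun f _ => by rw [hb, svec_three]
  have hc0 : ∏ f, b f ((0 : PT) f) = 1 / 16 := by
    simp only [Pi.zero_apply]; rw [hb, prod_svec_zero_univ]
  rw [hred, hc3, moment_three_eq_conj_moment_one, ← map_mul, hc0, moment_zero_eq_sum] at hS
  have hreal : ∑ τ : PT, (ω τ : ℂ) * ∏ f, (∑ j : ZMod 4, b f j * Complex.I ^ ((j * τ f).val)) =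
      ((∑ τ : PT, ω τ * ∏ f, uvec Finset.univ s f (τ f) : ℝ) : ℂ) := by
    push_cast
    refine Finset.sum_congr rfl fun τ _ => ?_
    congr 1
    exact Finset.prod_congr rfl fun f _ => by rw [hb]; exact trig_svec Finset.univ s f (τ f)
  rw [hreal, ← slabSum_eq_pairing, ← pbox_eq_slab_univ] at hS
  rw [boxSum]
  exact hS

/-- **BOX LAW with mass**: `32 · N(s) = 2 · (Σ_τ ω τ) − Re(e(−Σ s) · μ)` for every real measure whose non-zero clean moments vanish. -/
theorem boxSumLaw' (ω : PT → ℝ) (hK : ∀ k, KAdm k → k ≠ 0 → moment ω k = 0) (s : PT) :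
    32 * boxSum ω s = 2 * (∑ τ, ω τ) - (e (-∑ f, s f) * moment ω (fun _ => 1)).re := by
  have h := box_pairing' ω hK s
  rw [prod_svec_one_univ, Complex.add_conj,
    show (1 / 16 : ℂ) * ((∑ τ, ω τ : ℝ) : ℂ) = (((1 / 16 : ℝ) * ∑ τ, ω τ : ℝ) : ℂ) by push_cast; ring,
    ← Complex.ofReal_add] at h
  have h' := Complex.ofReal_injective h
  have hP : (-(e (-∑ f, s f)) / 64 * moment ω (fun _ => 1)).re = -(1 / 64) * (e (-∑ f, s f) * moment ω (fun _ => 1)).re := by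
    rw [show -(e (-∑ f, s f)) / 64 * moment ω (fun _ => 1) = ((-(1 / 64) : ℝ) : ℂ) * (e (-∑ f, s f) * moment ω (fun _ => 1)) by
      push_cast; ring, Complex.re_ofReal_mul]
  rw [hP] at h'
  linarith

end Summit.Ventures.HSemireg.PhaseTorus

namespace Summit.Ventures.HSemireg.BandPhaseTorus

open Finset BigOperators Summit.Ventures.HSemireg Summit.Ventures.HSemireg.Pad4Tower
open Summit.Ventures.HSemireg.LinePhaseTorus (lineCharge betaG mletter wordOf tau phaseOf unitG TopWord lineLetter LineCell)

/-! ## §2a axial letters: `(a, b·ζ_k)` — every letter of every `◇_h` -/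

/-- the axial letter of level `a`, modulus `b`, phase `k` (`lineLetter h c k = axLetter (h − c) c k`). -/
def axLetter (a : ℤ) (b : ℕ) (k : Fin 4) : BPoint := (a, (b : ℤ) * ![1, 0, -1, 0] k, (b : ℤ) * ![0, -1, 0, 1] k)

/-- a cell all of whose letters are axial. -/
def AxCell (Z : MCell) : Prop := ∀ f, ∃ a : ℤ, ∃ b : ℕ, ∃ k : Fin 4, Z f = axLetter a b k

/-- `b_f = |β_f|` (the ℓ¹ form, = the modulus on an axial letter). -/
def babs (Z : MCell) (f : Fin 4) : ℤ := |(Z f).2.1| + |(Z f).2.2|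

/-- the BAND DEFECT `d_f = c_f − b_f` (`c_f = h − α_f`; `0` on the LINE). -/
def defect (h : ℤ) (Z : MCell) (f : Fin 4) : ℤ := lineCharge h Z f - babs Z f

/-- the modulus of an axial letter `(a, b·ζ_k)` is `b`. -/
theorem babs_of_eq {Z : MCell} {f : Fin 4} {a : ℤ} {b : ℕ} {k : Fin 4} (hZ : Z f = axLetter a b k) : babs Z f = b := by
  unfold babs; rw [hZ]; fin_cases k <;> simp [axLetter]

/-- the Gaussian `β` of an axial letter `(a, b·ζ_k)` is `b · conj(i^k)`-type unit times `b`. -/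
theorem betaG_of_eq_ax {Z : MCell} {f : Fin 4} {a : ℤ} {b : ℕ} {k : Fin 4} (hZ : Z f = axLetter a b k) :
    betaG Z f = (b : GaussianInt) * unitG k := by
  rw [betaG, hZ, Zsqrtd.ext_iff]
  simp [axLetter, unitG]

/-- the phase index of an axial letter with `b > 0` is `k`. -/
theorem phaseOf_axLetter (a : ℤ) {b : ℕ} (hb : 0 < b) (k : Fin 4) : phaseOf (axLetter a b k) = k := by
  have hb' : (0 : ℤ) < b := by exact_mod_cast hb
  have hb0 : b ≠ 0 := hb.ne'
  fin_cases k <;> simp [phaseOf, axLetter, hb0, not_lt.mpr hb'.le]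

/-- a letter with `β` on an axis or zero IS an axial letter. -/
theorem exists_axLetter_of_axis (x : BPoint) (hx : x.2.1 = 0 ∨ x.2.2 = 0) :
    ∃ a : ℤ, ∃ b : ℕ, ∃ k : Fin 4, x = axLetter a b k := by
  obtain ⟨a, re, im⟩ := x
  simp only at hx
  rcases hx with h0 | h0 <;> subst h0
  · -- re = 0: β = i·im
    by_cases him : 0 ≤ im
    · refine ⟨a, im.toNat, 3, ?_⟩; simp [axLetter, Int.toNat_of_nonneg him]
    · refine ⟨a, (-im).toNat, 1, ?_⟩; simp [axLetter, Int.toNat_of_nonneg (by omega : (0:ℤ) ≤ -im)]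
  · by_cases hre : 0 ≤ re
    · refine ⟨a, re.toNat, 0, ?_⟩; simp [axLetter, Int.toNat_of_nonneg hre]
    · refine ⟨a, (-re).toNat, 2, ?_⟩; simp [axLetter, Int.toNat_of_nonneg (by omega : (0:ℤ) ≤ -re)]

/-- a cell whose letters lie on the axes is axial. -/
theorem axCell_of_axis {Z : MCell} (hZ : ∀ f, (Z f).2.1 = 0 ∨ (Z f).2.2 = 0) : AxCell Z :=
  fun f => exists_axLetter_of_axis (Z f) (hZ f)

/-- LINE cells are axial. -/
theorem axCell_of_lineCell {h : ℤ} {Z : MCell} (hZ : LineCell h Z) : AxCell Z := fun f => by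
  obtain ⟨c, k, e⟩ := hZ f
  exact ⟨h - c, c, k, by rw [e]; rfl⟩

/-! ## §2b the letters in `ℂ`: `β_f = b_f · e(τ_f)` -/

/-- in `ℂ`: `β_f = b_f · e(τ_f)` for an axial cell. -/
theorem toComplex_betaG_ax {Z : MCell} (hZ : AxCell Z) (f : Fin 4) :
    ((betaG Z f : GaussianInt) : ℂ) = (babs Z f : ℂ) * PhaseTorus.e (tau Z f) := by
  obtain ⟨a, b, k, e⟩ := hZ f
  rw [betaG_of_eq_ax e, babs_of_eq e, map_mul, map_natCast, LinePhaseTorus.toComplex_unitG]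
  push_cast
  rcases Nat.eq_zero_or_pos b with h0 | hpos
  · simp [h0]
  · congr 1
    simp only [tau, e, phaseOf_axLetter a hpos k]

/-- in `ℂ`: `β̄_f = b_f · e(−τ_f)` for an axial cell. -/
theorem toComplex_star_betaG_ax {Z : MCell} (hZ : AxCell Z) (f : Fin 4) :
    ((star (betaG Z f) : GaussianInt) : ℂ) = (babs Z f : ℂ) * PhaseTorus.e (3 * tau Z f) := by
  rw [GaussianInt.toComplex_star, toComplex_betaG_ax hZ f, map_mul, map_intCast, PhaseTorus.e_three_mul]

/-- the letter read by `k_f ∈ {0,1,3}`: `c_f` at `0`, `b_f e(k_f τ_f)` at `1, 3`. -/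
noncomputable def letterC (h : ℤ) (Z : MCell) (f : Fin 4) (j : ZMod 4) : ℂ :=
  if j = 0 then (lineCharge h Z f : ℂ) else (babs Z f : ℂ) * PhaseTorus.e (j * tau Z f)

/-- in `ℂ`: the moment letter of `wordOf k` at factor `f` of an axial cell is `letterC k_f`. -/
theorem toComplex_mletter_wordOf_ax {h : ℤ} {Z : MCell} (hZ : AxCell Z) (k : Fin 4 → ZMod 4) (f : Fin 4)
    (hk : k f ≠ 2) : ((mletter h Z f (wordOf k f) : GaussianInt) : ℂ) = letterC h Z f (k f) := by
  have h4 : ∀ y : ZMod 4, y = 0 ∨ y = 1 ∨ y = 2 ∨ y = 3 := by decide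
  unfold letterC
  rcases h4 (k f) with e | e | e | e
  · rw [LinePhaseTorus.wordOf_apply_zero e, e, if_pos rfl]
    simp [mletter]
  · rw [LinePhaseTorus.wordOf_apply_one e, e, if_neg (by decide), one_mul]
    simp only [mletter, Matrix.cons_val_two, Matrix.tail_cons, Matrix.head_cons]
    exact toComplex_betaG_ax hZ f
  · exact absurd e hk
  · rw [LinePhaseTorus.wordOf_apply_three e, e, if_neg (by decide)]
    simp only [mletter, Matrix.cons_val_three, Matrix.tail_cons, Matrix.head_cons]
    exact toComplex_star_betaG_ax hZ f

/-- in `ℂ`: the moment monomial of `wordOf k` of an axial cell is the product of the `letterC`. -/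
theorem toComplex_mono_wordOf_ax {h : ℤ} {Z : MCell} (hZ : AxCell Z) (k : Fin 4 → ZMod 4) (hk : ∀ f, k f ≠ 2) :
    ((LinePhaseTorus.MCell.mono h Z (wordOf k) : GaussianInt) : ℂ) = ∏ f, letterC h Z f (k f) := by
  unfold LinePhaseTorus.MCell.mono
  rw [map_prod]
  exact Finset.prod_congr rfl fun f _ => toComplex_mletter_wordOf_ax hZ k f (hk f)

/-! ## §2c the SMEARED measure of a design and its Fourier transform -/

/-- the smeared weight of factor `f` of the cell `Z` at phase `u`: `b_f [u = τ_f] + d_f ∕ 4`. -/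
noncomputable def wt (h : ℤ) (Z : MCell) (f : Fin 4) (u : ZMod 4) : ℝ :=
  (babs Z f : ℝ) * (if u = tau Z f then 1 else 0) + (defect h Z f : ℝ) / 4

/-- the SMEARED phase measure of an integer design (product weights per cell, signed multiplicities `m_N, −m_P`). -/
noncomputable def omegaB (h : ℤ) (C : MConfig) (mN mP : MCell → ℤ) (t : Fin 4 → ZMod 4) : ℝ :=
  (∑ Z ∈ C.lower, (mN Z : ℝ) * ∏ f, wt h Z f (t f)) - ∑ P ∈ C.upper, (mP P : ℝ) * ∏ f, wt h P f (t f)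

/-- one factor's Fourier transform: `Σ_u wt(u) e(j u) = letterC j` for `j ≠ 2`. -/
theorem wt_transform {h : ℤ} (Z : MCell) (f : Fin 4) (j : ZMod 4) (hj : j ≠ 2) :
    ∑ u : ZMod 4, (wt h Z f u : ℂ) * PhaseTorus.e (j * u) = letterC h Z f j := by
  have hsplit : ∑ u : ZMod 4, (wt h Z f u : ℂ) * PhaseTorus.e (j * u) =
      (babs Z f : ℂ) * PhaseTorus.e (j * tau Z f) + ((defect h Z f : ℂ) / 4) * ∑ u : ZMod 4, PhaseTorus.e (j * u) := by
    have hw : ∀ u, (wt h Z f u : ℂ) * PhaseTorus.e (j * u) =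
        (babs Z f : ℂ) * (if u = tau Z f then PhaseTorus.e (j * u) else 0) + ((defect h Z f : ℂ) / 4) * PhaseTorus.e (j * u) := by
      intro u; unfold wt; split_ifs <;> push_cast <;> ring
    simp_rw [hw]
    rw [Finset.sum_add_distrib, ← Finset.mul_sum, ← Finset.mul_sum, Finset.sum_ite_eq' Finset.univ (tau Z f)]
    simp
  rw [hsplit, PhaseTorus.charSum_e]
  unfold letterC
  by_cases h0 : j = 0
  · subst h0
    rw [if_pos rfl, if_pos rfl, zero_mul, PhaseTorus.e_zero, mul_one]
    unfold defect; push_cast; ring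
  · rw [if_neg h0, if_neg h0, mul_zero, add_zero]

/-- Fubini for a product weight over the torus. -/
theorem sum_prod_wt_chi {h : ℤ} (Z : MCell) (k : Fin 4 → ZMod 4) :
    ∑ t : Fin 4 → ZMod 4, (∏ f, (wt h Z f (t f) : ℂ)) * PhaseTorus.chi k t =
      ∏ f, ∑ u : ZMod 4, (wt h Z f u : ℂ) * PhaseTorus.e (k f * u) := by
  simp_rw [PhaseTorus.chi_eq_prod_e, ← Finset.prod_mul_distrib]
  rw [Finset.prod_univ_sum]
  simp only [Fintype.piFinset_univ]

/-- **dictionary**: the torus moments of the smeared measure are the design moments (frequencies without a `2`). -/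
theorem omegaB_moment (h : ℤ) (C : MConfig) (mN mP : MCell → ℤ) (hax : ∀ Z ∈ C.lower ∪ C.upper, AxCell Z)
    (k : Fin 4 → ZMod 4) (hk : ∀ f, k f ≠ 2) :
    PhaseTorus.moment (omegaB h C mN mP) k = ((LinePhaseTorus.moment h C mN mP (wordOf k) : GaussianInt) : ℂ) := by
  classical
  have hL : ∀ Z ∈ C.lower, AxCell Z := fun Z hZ => hax Z (Finset.mem_union_left _ hZ)
  have hU : ∀ P ∈ C.upper, AxCell P := fun P hP => hax P (Finset.mem_union_right _ hP)
  have hcell : ∀ Z, AxCell Z → ∑ t : Fin 4 → ZMod 4, (∏ f, (wt h Z f (t f) : ℂ)) * PhaseTorus.chi k t =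
      ((LinePhaseTorus.MCell.mono h Z (wordOf k) : GaussianInt) : ℂ) := fun Z hZ => by
    rw [sum_prod_wt_chi, toComplex_mono_wordOf_ax hZ k hk]
    exact Finset.prod_congr rfl fun f _ => wt_transform Z f (k f) (hk f)
  unfold PhaseTorus.moment omegaB LinePhaseTorus.moment
  push_cast
  simp_rw [sub_mul, Finset.sum_mul, Finset.sum_sub_distrib]
  rw [Finset.sum_comm, Finset.sum_comm (s := Finset.univ) (t := C.upper)]
  simp_rw [mul_assoc, ← Finset.mul_sum]
  rw [map_sub, map_sum, map_sum]
  congr 1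
  · refine Finset.sum_congr rfl fun Z hZ => ?_
    rw [hcell Z (hL Z hZ), zsmul_eq_mul, map_mul, map_intCast]
  · refine Finset.sum_congr rfl fun P hP => ?_
    rw [hcell P (hU P hP), zsmul_eq_mul, map_mul, map_intCast]

/-- **(A1) ⇒ the smeared measure is clean off `{0, ±(1,1,1,1)}`** (alphabet-free: `moment_eq_zero_of_beta`). -/
theorem omegaB_clean (h : ℤ) (C : MConfig) (mN mP : MCell → ℤ) (hax : ∀ Z ∈ C.lower ∪ C.upper, AxCell Z)
    (hA1 : ClassScreen (C.wch mN mP)) (k : Fin 4 → ZMod 4) (hk : PhaseTorus.KAdm k) (hk0 : k ≠ 0) :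
    PhaseTorus.moment (omegaB h C mN mP) k = 0 := by
  obtain ⟨hk2, hk1, hk3⟩ := hk
  obtain ⟨f, hf⟩ : ∃ f, k f ≠ 0 := by
    by_contra hc; push Not at hc; exact hk0 (funext hc)
  have h4 : ∀ y : ZMod 4, y = 0 ∨ y = 1 ∨ y = 2 ∨ y = 3 := by decide
  have hwf : wordOf k f = 2 ∨ wordOf k f = 3 := by
    rcases h4 (k f) with e | e | e | e
    · exact absurd e hf
    · exact Or.inl (LinePhaseTorus.wordOf_apply_one e)
    · exact absurd e (hk2 f)
    · exact Or.inr (LinePhaseTorus.wordOf_apply_three e)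
  rw [omegaB_moment h C mN mP hax k hk2, LinePhaseTorus.moment_eq_zero_of_beta h C mN mP hA1 (wordOf k) hwf
    (LinePhaseTorus.wordOf_ne hk2 (Or.inl ⟨rfl, rfl⟩) hk1) (LinePhaseTorus.wordOf_ne hk2 (Or.inr ⟨rfl, rfl⟩) hk3), map_zero]

/-- the MASS `M₀ = N(cccc) = Σ ν ∏_f c_f` of a design. -/
def mass (h : ℤ) (C : MConfig) (mN mP : MCell → ℤ) : ℤ :=
  (∑ Z ∈ C.lower, mN Z * ∏ f, lineCharge h Z f) - ∑ P ∈ C.upper, mP P * ∏ f, lineCharge h P f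

/-- the `cccc` moment is the mass `M₀`. -/
theorem moment_cccc_eq_mass (h : ℤ) (C : MConfig) (mN mP : MCell → ℤ) :
    LinePhaseTorus.moment h C mN mP (fun _ => 1) = (mass h C mN mP : GaussianInt) := by
  unfold LinePhaseTorus.moment mass
  push_cast
  simp_rw [LinePhaseTorus.mono_one, zsmul_eq_mul]
  push_cast
  rfl

/-- `wordOf 0 = cccc`. -/
theorem wordOf_zero : wordOf (0 : Fin 4 → ZMod 4) = fun _ => 1 := by
  funext f; exact LinePhaseTorus.wordOf_apply_zero rfl

/-- **mass**: `Σ_t ω̃(t) = M₀`. -/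
theorem omegaB_mass (h : ℤ) (C : MConfig) (mN mP : MCell → ℤ) (hax : ∀ Z ∈ C.lower ∪ C.upper, AxCell Z) :
    ∑ t, omegaB h C mN mP t = (mass h C mN mP : ℝ) := by
  have h0 := omegaB_moment h C mN mP hax 0 (fun f => by rw [Pi.zero_apply]; decide)
  rw [PhaseTorus.moment_zero_eq_sum, wordOf_zero, moment_cccc_eq_mass] at h0
  have h1 : (((∑ t, omegaB h C mN mP t : ℝ)) : ℂ) = ((mass h C mN mP : ℝ) : ℂ) := by
    rw [h0]; simp
  exact_mod_cast h1

/-- **top**: the top torus moment of `ω̃` is `μ = wch(eeee)`. -/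
theorem omegaB_top (h : ℤ) (C : MConfig) (mN mP : MCell → ℤ) (hax : ∀ Z ∈ C.lower ∪ C.upper, AxCell Z) :
    PhaseTorus.moment (omegaB h C mN mP) (fun _ => 1) = ((C.wch mN mP eWord : GaussianInt) : ℂ) := by
  rw [omegaB_moment h C mN mP hax (fun _ => 1) (fun _ => by decide), LinePhaseTorus.wordOf_one,
    LinePhaseTorus.wch_eWord_eq_moment_beta h]


end Summit.Ventures.HSemireg.BandPhaseTorus
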